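import Summits.Ventures.YMGap.Conjectures.StrongCouplingChiralLROSchwingerDysonSetup
import HarnessLib
import HarnessLib.Audit.Tags

/-!
# Row S4 of Y3 at `β ≥ 0` (2/3): one link at a time — the bond polynomial and the plaquette oscillation

Cell `pub-ymgap`, seat qcd-lit g19, `bears_on: Q1`; sequel of `…SchwingerDysonSetup` (notation there).
Everything is a theorem (0 facts).  For a bond `b ∋ x` (`x` even) and `F` in the chiral cone consider the
bond term `I_b(F) = ∫ e^{-βS_W} ∫dψ̄dψ F · kin_{x,b}(U) · e^{A(U)}` of the fixed-gauge Schwinger–Dyson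
equation (`StaggeredSchwingerDysonFixedGauge`).  Resampling the link variable `U_b =: g`:
* `norm_berezin_kinAt_le` — at EVERY gauge field, `|∫dψ̄dψ F kin_{x,b} e^{A}| ≤ (N√N/2)(s∫F(σσ)_b e^A + s∫F e^A)`
  (fixed-gauge Cauchy–Schwarz of `StaggeredChiralSwapPositivity` and `2√(ab) ≤ a + b`);
* `integral_kinAt_update_eq`, `mainTerm_eq` — integrating `g` against Haar FIRST (plaquette weight frozen
  at `U[b←1]`) reproduces Salmhofer–Seiler's bond polynomial: `N ∑_i i w_i ∫∫ e^{-βS_W(U[b←1])} ∫ F(σσ)_b^i e^{A(U[b←g])}`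
  [SalmhoferSeiler1991, (3.44)–(3.46) with (2.16)–(2.19)];
* `mainTerm_bounds` — unfreezing the plaquette weight costs factors `e^{±βc}`, `c = linkOsc ν N`
  volume-independent (`GaugeLinkResampling`);
* `norm_remainder_le` — the remainder is at most `κ(β)(S_β(F(σσ)_b) + S_β(F))`,
  `κ(β) = (e^{βc}-1)e^{βc}N√N/2` (`kap`), `κ(0) = 0`.

[cite: SalmhoferSeiler1991, (3.44)–(3.46), (3.61)–(3.62), (4.31)–(4.34)]; [cite: SeilerLNP1982, Ch. 2].
-/

noncomputable section

open MeasureTheory Finset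
open scoped ComplexConjugate Matrix BigOperators
open Literature.MathematicalPhysics.QuantumFieldTheory (Site Edge GaugeConfig wilsonAction wilsonWeight wilsonMeasure
  partitionFunction haarProbability)
open Literature.MathematicalPhysics.QuantumLattice
open Literature.MathematicalPhysics.QuantumLattice.GrassmannAlgebra
open Literature.MathematicalPhysics.QuantumLattice.StrongCoupling
open Literature.MathematicalPhysics.QuantumLattice.StaggeredRP (expect definingRep eoParity_torusLinks)
open Literature.MathematicalPhysics.QuantumLattice.StaggeredDeterminant (eoParity)
open Literature.MathematicalPhysics.StatisticalMechanics (ComplexSpin.HasLog ComplexSpin.uNBondCoeff)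
open Literature.Probability.LatticeModels (TorusSite)

namespace Summit.Ventures.YMGap.Conjectures

namespace SchwingerDyson

variable {N ν L : ℕ} [NeZero L]

variable [LinearOrder (TorusSite ν L)]

/-! ### The spin pair of a bond and the chiral cone -/

omit [NeZero L] in
/-- `σ_xσ_y = r ψ̄ψ(x)ψ̄ψ(y)` with the real scalar `r = 1/(2N)²`. [cite: SalmhoferSeiler1991, §2 (2.20)–(2.21)] -/
theorem spinPair_eq_real_smul (x y : TorusSite ν L) :
    (spinPair x y : FermiAlg (TorusSite ν L) N) = ((1 / (4 * (N : ℝ) ^ 2) : ℝ) : ℂ) • (meson x * meson y) := by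
  rw [spinPair]; congr 1; push_cast; ring

/-- Powers `(σ_xσ_y)^k` lie in the chiral cone. [cite: MontvayMunster1994, §5.1.6 (5.120)–(5.121)] -/
theorem isChiralPositive_spinPair_pow (x y : TorusSite ν L) (k : ℕ) :
    IsChiralPositive (N := N) (evens ν L) (spinPair x y ^ k) := by
  rw [spinPair_eq_real_smul]
  exact isChiralPositive_smul_meson_mul_meson_pow _ (by positivity) x y k

omit [NeZero L] in
/-- `σ_xσ_y = σ_yσ_x`. [cite: SalmhoferSeiler1991, §2 (2.20)] -/
theorem spinPair_comm (x y : TorusSite ν L) : (spinPair x y : FermiAlg (TorusSite ν L) N) = spinPair y x := by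
  rw [spinPair, spinPair, (commute_meson x _).eq]

/-! ### The set of bonds at a site -/

variable (ν L) in
/-- The links containing the site `x`: `(x, μ)` and `(x - e_μ, μ)`. [cite: SalmhoferSeiler1991, (3.46)] -/
def bondsAt (x : TorusSite ν L) : Finset (Edge ν L) :=
  Finset.univ.filter fun ℓ : Edge ν L => ℓ.1 = x ∨ ℓ.1.shift ℓ.2 = x

omit [LinearOrder (TorusSite ν L)] in
/-- Membership in `bondsAt x`. [cite: SalmhoferSeiler1991, (3.46)] -/
theorem mem_bondsAt {x : TorusSite ν L} {ℓ : Edge ν L} :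
    ℓ ∈ bondsAt ν L x ↔ (torusLinks ν L ℓ).1 = x ∨ (torusLinks ν L ℓ).2 = x := by
  simp [bondsAt, torusLinks, Site.shift]

omit [LinearOrder (TorusSite ν L)] in
/-- A site has at most `2ν` links. [cite: SalmhoferSeiler1991, (3.46)] -/
theorem card_bondsAt_le (x : TorusSite ν L) : (bondsAt ν L x).card ≤ ν + ν := card_filter_incident_le x

/-! ### The pointwise bound for the kinetic insertion (every gauge field) -/

/-- `2√a√b ≤ a + b`. [cite: SalmhoferSeiler1991, (3.61)] -/
theorem two_mul_sqrt_mul_sqrt_le {a b : ℝ} (ha : 0 ≤ a) (hb : 0 ≤ b) : 2 * (Real.sqrt a * Real.sqrt b) ≤ a + b := by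
  nlinarith [sq_nonneg (Real.sqrt a - Real.sqrt b), Real.sq_sqrt ha, Real.sq_sqrt hb]

variable (N ν) in
/-- The error constant `κ(β) = (e^{βc} - 1) e^{βc} · N√N/2`, `c = linkOsc ν N`; `κ(0) = 0`. [cite: SeilerLNP1982, Ch. 2] -/
def kap (β : ℝ) : ℝ :=
  (Real.exp (β * linkOsc ν N) - 1) * Real.exp (β * linkOsc ν N) * ((N : ℝ) * Real.sqrt N / 2)

omit [NeZero L] [LinearOrder (TorusSite ν L)] in
/-- `κ(β) ≥ 0` for `β ≥ 0`. [cite: SeilerLNP1982, Ch. 2] -/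
theorem kap_nonneg {β : ℝ} (hβ : 0 ≤ β) : 0 ≤ kap N ν β := by
  unfold kap
  have h1 : 1 ≤ Real.exp (β * linkOsc ν N) := Real.one_le_exp (mul_nonneg hβ (linkOsc_nonneg ν N))
  have h2 : 0 ≤ (N : ℝ) * Real.sqrt N / 2 := by positivity
  exact mul_nonneg (mul_nonneg (by linarith) (by linarith)) h2

/-- **The kinetic insertion is controlled by the two neighbouring cone elements, at EVERY gauge field**:
`|∫dψ̄dψ F kin_{x,b}(V) e^{A(V)}| ≤ (N√N/2) (s∫ F (σσ)_b e^{A(V)} + s∫ F e^{A(V)})` for `x` even, `b ∋ x`,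
`F` in the cone (Cauchy–Schwarz at fixed gauge field and `2√(ab) ≤ a + b`). [cite: SalmhoferSeiler1991, (3.61)–(3.62)] -/
theorem norm_berezin_kinAt_le (hL : Even L) (hN : N ≠ 0) {x : TorusSite ν L} (hx : x ∈ evens ν L) {e : Edge ν L}
    (hxe : (torusLinks ν L e).1 = x ∨ (torusLinks ν L e).2 = x) {F : FermiAlg (TorusSite ν L) N}
    (hF : IsChiralPositive (evens ν L) F) (V : GaugeConfig ν L (UN N)) :
    ‖berezin ℂ _ (F * kinAt x (torusLinks ν L) (stagSigns ν L) V e * fermiW V)‖ ≤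
      ((N : ℝ) * Real.sqrt N / 2) *
        ((chiralSign (N := N) (evens ν L) *
            berezin ℂ _ (F * spinPair (torusLinks ν L e).1 (torusLinks ν L e).2 * fermiW V)).re +
          (chiralSign (N := N) (evens ν L) * berezin ℂ _ (F * fermiW V)).re) := by
  have hle : (torusLinks ν L e).1 ≠ (torusLinks ν L e).2 := torusLinks_ne (StaggeredRP.one_lt_of_even_neZero hL) e
  have hl := fst_mem_evens_iff (ν := ν) hL
  -- the generic Cauchy–Schwarz step, for a hop `ψ̄(x) M ψ(z)` with `z` odd and `M` unitary
  have key : ∀ (z : TorusSite ν L), z ∉ evens ν L → ∀ (M : Matrix (Fin N) (Fin N) ℂ), M ∈ Matrix.unitaryGroup (Fin N) ℂ →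
      (meson x * meson z : FermiAlg (TorusSite ν L) N) =
        (((2 * N : ℝ) ^ 2 : ℝ) : ℂ) • spinPair (torusLinks ν L e).1 (torusLinks ν L e).2 →
      ∀ c : ℂ, ‖c‖ = 1 / 2 →
      ‖berezin ℂ _ (F * (c • hopAt x z M) * fermiW V)‖ ≤ ((N : ℝ) * Real.sqrt N / 2) *
        ((chiralSign (N := N) (evens ν L) *
            berezin ℂ _ (F * spinPair (torusLinks ν L e).1 (torusLinks ν L e).2 * fermiW V)).re +
          (chiralSign (N := N) (evens ν L) * berezin ℂ _ (F * fermiW V)).re) := by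
    intro z hz M hM hMM c hc
    have hcs := norm_berezin_hopAt_actionOn_le Finset.univ (torusLinks ν L) hl conj_stagSigns V hF hx hz M
    rw [hsNorm_of_mem_unitaryGroup hM, hMM] at hcs
    set r1 := (chiralSign (N := N) (evens ν L) *
      berezin ℂ _ (F * spinPair (torusLinks ν L e).1 (torusLinks ν L e).2 * fermiW V)).re with hr1
    set r0 := (chiralSign (N := N) (evens ν L) * berezin ℂ _ (F * fermiW V)).re with hr0
    have h1 : 0 ≤ r1 := (chiralSign_mul_berezin_fermiW hL (hF.mul (isChiralPositive_spinPair_pow _ _ 1)) V).1 |>.trans_eq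
      (by rw [hr1, pow_one])
    have h0 : 0 ≤ r0 := (chiralSign_mul_berezin_fermiW hL hF V).1
    have hsm : (chiralSign (N := N) (evens ν L) * berezin ℂ _ (F * ((((2 * N : ℝ) ^ 2 : ℝ) : ℂ) •
        spinPair (torusLinks ν L e).1 (torusLinks ν L e).2) * fermiW V)).re = (2 * N : ℝ) ^ 2 * r1 := by
      rw [mul_smul_comm, smul_mul_assoc, map_smul, smul_eq_mul, mul_left_comm, Complex.re_ofReal_mul, hr1]
    rw [hsm, Real.sqrt_mul' _ h1, Real.sqrt_sq (by positivity)] at hcs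
    rw [mul_smul_comm, smul_mul_assoc, map_smul, smul_eq_mul, norm_mul, hc]
    have hN0 : (0 : ℝ) ≤ N := Nat.cast_nonneg N
    calc 1 / 2 * ‖berezin ℂ _ (F * hopAt x z M * grassmannExp (actionOn univ (torusLinks ν L) (stagSigns ν L) V))‖
        ≤ 1 / 2 * (Real.sqrt N * (2 * N * Real.sqrt r1) * Real.sqrt r0) := mul_le_mul_of_nonneg_left hcs (by norm_num)
      _ = (N : ℝ) * Real.sqrt N / 2 * (2 * (Real.sqrt r1 * Real.sqrt r0)) := by ring
      _ ≤ (N : ℝ) * Real.sqrt N / 2 * (r1 + r0) :=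
          mul_le_mul_of_nonneg_left (two_mul_sqrt_mul_sqrt_le h1 h0) (by positivity)
  have hc : ‖stagSigns ν L e / 2‖ = 1 / 2 := by rw [norm_div, norm_stagSigns]; simp
  rcases hxe with h1 | h2
  · -- `b = (x, z)`: `kin = -(Γ/2) ψ̄(x) U_b ψ(z)`
    have h2 : (torusLinks ν L e).2 ≠ x := fun h => hle (h1.trans h.symm)
    have hz : (torusLinks ν L e).2 ∉ evens ν L := (hl e).mp (h1 ▸ hx)
    rw [kinAt_eq_of_fst h1 h2]
    refine key _ hz _ (V e).2 ?_ _ (by rw [norm_neg, hc])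
    rw [← h1]; exact meson_mul_meson_eq_smul_spinPair hN _ _
  · -- `b = (z, x)`: `kin = (Γ/2) ψ̄(x) U_b† ψ(z)`
    have h1 : (torusLinks ν L e).1 ≠ x := fun h => hle (h.trans h2.symm)
    have hz : (torusLinks ν L e).1 ∉ evens ν L := fun h => ((hl e).mp h) (h2 ▸ hx)
    rw [kinAt_eq_of_snd h1 h2]
    refine key _ hz _ (Unitary.star_mem (V e).2) ?_ _ hc
    rw [(commute_meson x _).eq, ← h2]; exact meson_mul_meson_eq_smul_spinPair hN _ _

/-! ### Integrating out one link: the main term reproduces the bond polynomial -/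

/-- **One-link Haar integral of the insertion term, every remaining gauge field** (Salmhofer–Seiler's
(3.44)–(3.46) one link at a time): `∫dg ∫dψ̄dψ F kin_{x,b}(U[b←g]) e^{A(U[b←g])} = N ∑_i i w_i ∫dg ∫dψ̄dψ F (σσ)_b^i e^{A(U[b←g])}`. [cite: SalmhoferSeiler1991, (3.44)–(3.46) with (2.16)–(2.19)] -/
theorem integral_kinAt_update_eq (hL : Even L) (hN : N ≠ 0) {x : TorusSite ν L} {e : Edge ν L}
    (hxe : (torusLinks ν L e).1 = x ∨ (torusLinks ν L e).2 = x) (F : FermiAlg (TorusSite ν L) N)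
    {w : ℕ → ℝ} (hlog : ComplexSpin.HasLog N (ComplexSpin.uNBondCoeff N) w) (U : GaugeConfig ν L (UN N)) :
    ∫ g, berezin ℂ _ (F * kinAt x (torusLinks ν L) (stagSigns ν L) (Function.update U e g) e * fermiW (Function.update U e g))
        ∂(haarProbability (UN N)) =
      (N : ℂ) * ∑ i ∈ Finset.range (N + 1), ((i : ℂ) * w i) *
        ∫ g, berezin ℂ _ (F * spinPair (torusLinks ν L e).1 (torusLinks ν L e).2 ^ i * fermiW (Function.update U e g))
          ∂(haarProbability (UN N)) := by
  have hle : (torusLinks ν L e).1 ≠ (torusLinks ν L e).2 := torusLinks_ne (StaggeredRP.one_lt_of_even_neZero hL) e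
  have hz : x = (torusLinks ν L e).1 ∨ x = (torusLinks ν L e).2 := hxe.elim (fun h => Or.inl h.symm) fun h => Or.inr h.symm
  have h1 := integral_berezin_kinAt_update x (Finset.mem_univ e) (torusLinks ν L) hle (Γ := stagSigns ν L) (stagSigns_sq e) U F
  have h2 := fun i : ℕ => integral_berezin_update (Finset.mem_univ e) (torusLinks ν L) hle (Γ := stagSigns ν L) (stagSigns_sq e) U
    (F * spinPair (torusLinks ν L e).1 (torusLinks ν L e).2 ^ i)
  simp only [fermiW] at h1 h2 ⊢
  rw [h1, chargeOp_bar_bondFactor_eq_of_hasLog hN hle hz hlog]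
  simp_rw [h2]
  rw [mul_smul_comm, smul_mul_assoc, map_smul, smul_eq_mul, Finset.sum_mul, Finset.mul_sum, Finset.sum_mul, map_sum]
  congr 1
  refine Finset.sum_congr rfl fun i _ => ?_
  simp only [smul_mul_assoc, mul_smul_comm, map_smul, smul_eq_mul, mul_assoc]

/-! ### Continuity of the product-space integrands -/

/-- `p ↦ ∫dψ̄dψ G e^{A(U[e←g])}` is continuous. [cite: SalmhoferSeiler1991, §2 (2.12)] -/
theorem continuous_berezin_upd (hL : Even L) (e : Edge ν L) (G : FermiAlg (TorusSite ν L) N) :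
    Continuous fun p : GaugeConfig ν L (UN N) × UN N => berezin ℂ _ (G * fermiW (Function.update p.1 e p.2)) :=
  continuous_apply_of_coeffContinuous ((CoeffContinuous.const G).mul ((coeffContinuous_fermiW hL).comp (continuous_upd e))) _

/-- `p ↦ ∫dψ̄dψ F kin_{x,b}(U[e←g]) e^{A(U[e←g])}` is continuous. [cite: SalmhoferSeiler1991, §2 (2.12)] -/
theorem continuous_berezin_kin_upd (hL : Even L) (x : TorusSite ν L) (e : Edge ν L) (F : FermiAlg (TorusSite ν L) N) :
    Continuous fun p : GaugeConfig ν L (UN N) × UN N =>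
      berezin ℂ _ (F * kinAt x (torusLinks ν L) (stagSigns ν L) (Function.update p.1 e p.2) e * fermiW (Function.update p.1 e p.2)) :=
  continuous_apply_of_coeffContinuous ((((CoeffContinuous.const F).mul ((coeffContinuous_kinAt x e).comp (continuous_upd e))).mul
    ((coeffContinuous_fermiW hL).comp (continuous_upd e)))) _

omit [LinearOrder (TorusSite ν L)] in
/-- `p ↦ e^{-βS_W(U[e←g])}` is continuous. [cite: SalmhoferSeiler1991, §2 (2.2)] -/
theorem continuous_plaq_upd (β : ℝ) (e : Edge ν L) :
    Continuous fun p : GaugeConfig ν L (UN N) × UN N => plaq N ν L β (Function.update p.1 e p.2) :=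
  (continuous_plaq β).comp (continuous_upd e)

omit [LinearOrder (TorusSite ν L)] in
/-- `p ↦ e^{-βS_W(U[e←1])}` is continuous. [cite: SalmhoferSeiler1991, §2 (2.2)] -/
theorem continuous_plaq_upd_one (β : ℝ) (e : Edge ν L) :
    Continuous fun p : GaugeConfig ν L (UN N) × UN N => plaq N ν L β (Function.update p.1 e 1) :=
  (continuous_plaq β).comp (continuous_fst.update e continuous_const)

/-! ### The main term on the product space, and its comparison with `S_β` -/

/-- **Main term**: `∫∫ e^{-βS_W(U[b←1])} ∫dψ̄dψ F kin_{x,b}(U[b←g]) e^{A(U[b←g])} = N ∑_i i w_i ∫∫ e^{-βS_W(U[b←1])} ∫dψ̄dψ F (σσ)_b^i e^{A(U[b←g])}`. [cite: SalmhoferSeiler1991, (3.44)–(3.46)] -/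
theorem mainTerm_eq (hL : Even L) (hN : N ≠ 0) (β : ℝ) {x : TorusSite ν L} {e : Edge ν L}
    (hxe : (torusLinks ν L e).1 = x ∨ (torusLinks ν L e).2 = x) (F : FermiAlg (TorusSite ν L) N)
    {w : ℕ → ℝ} (hlog : ComplexSpin.HasLog N (ComplexSpin.uNBondCoeff N) w) :
    ∫ p, (plaq N ν L β (Function.update p.1 e 1) : ℂ) *
        berezin ℂ _ (F * kinAt x (torusLinks ν L) (stagSigns ν L) (Function.update p.1 e p.2) e * fermiW (Function.update p.1 e p.2))
        ∂((haarPi N ν L).prod (haarProbability (UN N))) =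
      (N : ℂ) * ∑ i ∈ Finset.range (N + 1), ((i : ℂ) * w i) *
        ∫ p, (plaq N ν L β (Function.update p.1 e 1) : ℂ) *
          berezin ℂ _ (F * spinPair (torusLinks ν L e).1 (torusLinks ν L e).2 ^ i * fermiW (Function.update p.1 e p.2))
          ∂((haarPi N ν L).prod (haarProbability (UN N))) := by
  have hA : Integrable (fun p : GaugeConfig ν L (UN N) × UN N => (plaq N ν L β (Function.update p.1 e 1) : ℂ) *
      berezin ℂ _ (F * kinAt x (torusLinks ν L) (stagSigns ν L) (Function.update p.1 e p.2) e * fermiW (Function.update p.1 e p.2)))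
      ((haarPi N ν L).prod (haarProbability (UN N))) :=
    integrable_of_continuous_prod ((Complex.continuous_ofReal.comp (continuous_plaq_upd_one β e)).mul (continuous_berezin_kin_upd hL x e F))
  have hB : ∀ i : ℕ, Integrable (fun p : GaugeConfig ν L (UN N) × UN N => (plaq N ν L β (Function.update p.1 e 1) : ℂ) *
      berezin ℂ _ (F * spinPair (torusLinks ν L e).1 (torusLinks ν L e).2 ^ i * fermiW (Function.update p.1 e p.2)))
      ((haarPi N ν L).prod (haarProbability (UN N))) := fun i =>
    integrable_of_continuous_prod ((Complex.continuous_ofReal.comp (continuous_plaq_upd_one β e)).mul (continuous_berezin_upd hL e _))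
  have hinner : ∀ U : GaugeConfig ν L (UN N),
      ∫ g, (plaq N ν L β (Function.update U e 1) : ℂ) *
          berezin ℂ _ (F * kinAt x (torusLinks ν L) (stagSigns ν L) (Function.update U e g) e * fermiW (Function.update U e g))
          ∂(haarProbability (UN N)) =
        (N : ℂ) * ∑ i ∈ Finset.range (N + 1), ((i : ℂ) * w i) *
          ∫ g, (plaq N ν L β (Function.update U e 1) : ℂ) *
            berezin ℂ _ (F * spinPair (torusLinks ν L e).1 (torusLinks ν L e).2 ^ i * fermiW (Function.update U e g))
            ∂(haarProbability (UN N)) := by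
    intro U
    rw [integral_const_mul, integral_kinAt_update_eq hL hN hxe F hlog U, Finset.mul_sum, Finset.mul_sum, Finset.mul_sum]
    refine Finset.sum_congr rfl fun i _ => ?_
    rw [integral_const_mul]
    ring
  calc _ = ∫ U, ∫ g, (plaq N ν L β (Function.update U e 1) : ℂ) *
          berezin ℂ _ (F * kinAt x (torusLinks ν L) (stagSigns ν L) (Function.update U e g) e * fermiW (Function.update U e g))
          ∂(haarProbability (UN N)) ∂(haarPi N ν L) := integral_prod _ hA
    _ = ∫ U, (N : ℂ) * ∑ i ∈ Finset.range (N + 1), ((i : ℂ) * w i) *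
          ∫ g, (plaq N ν L β (Function.update U e 1) : ℂ) *
            berezin ℂ _ (F * spinPair (torusLinks ν L e).1 (torusLinks ν L e).2 ^ i * fermiW (Function.update U e g))
            ∂(haarProbability (UN N)) ∂(haarPi N ν L) := integral_congr_ae (ae_of_all _ hinner)
    _ = (N : ℂ) * ∑ i ∈ Finset.range (N + 1), ((i : ℂ) * w i) *
          ∫ U, ∫ g, (plaq N ν L β (Function.update U e 1) : ℂ) *
            berezin ℂ _ (F * spinPair (torusLinks ν L e).1 (torusLinks ν L e).2 ^ i * fermiW (Function.update U e g))
            ∂(haarProbability (UN N)) ∂(haarPi N ν L) := by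
        rw [integral_const_mul, integral_finsetSum _ fun i _ => ((hB i).integral_prod_left.const_mul _)]
        congr 1
        exact Finset.sum_congr rfl fun i _ => integral_const_mul _ _
    _ = _ := by
        congr 1
        exact Finset.sum_congr rfl fun i _ => by rw [integral_prod _ (hB i)]

/-- `s ∫∫ e^{-βS_W(U[b←1])} ∫dψ̄dψ G e^{A(U[b←g])}` is the real number `∫∫ e^{-βS_W(U[b←1])} · s∫dψ̄dψ G e^{A(U[b←g])}`. [cite: MontvayMunster1994, §5.1.6 (5.120)–(5.121)] -/
theorem chiralSign_mul_mainTerm_eq (hL : Even L) (β : ℝ) (e : Edge ν L) {G : FermiAlg (TorusSite ν L) N}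
    (hG : IsChiralPositive (evens ν L) G) :
    chiralSign (N := N) (evens ν L) * ∫ p, (plaq N ν L β (Function.update p.1 e 1) : ℂ) *
        berezin ℂ _ (G * fermiW (Function.update p.1 e p.2)) ∂((haarPi N ν L).prod (haarProbability (UN N))) =
      ((∫ p, plaq N ν L β (Function.update p.1 e 1) *
        (chiralSign (N := N) (evens ν L) * berezin ℂ _ (G * fermiW (Function.update p.1 e p.2))).re
          ∂((haarPi N ν L).prod (haarProbability (UN N))) : ℝ) : ℂ) := by
  rw [← integral_const_mul, ← integral_complex_ofReal]
  refine integral_congr_ae (ae_of_all _ fun p => ?_)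
  dsimp only
  rw [mul_left_comm, chiralSign_mul_berezin_fermiW_eq_re hL hG, Complex.ofReal_re]
  push_cast
  ring

/-- **Comparison of the main term with `S_β`** (the plaquette weight changes by at most `e^{±βc}` when the
link `b` changes): `e^{-βc} S_β(G) ≤ s·main(G) ≤ e^{βc} S_β(G)`, `β ≥ 0`, `G` in the cone. [cite: SeilerLNP1982, Ch. 2] -/
theorem mainTerm_bounds (hL : Even L) {β : ℝ} (hβ : 0 ≤ β) (e : Edge ν L) {G : FermiAlg (TorusSite ν L) N}
    (hG : IsChiralPositive (evens ν L) G) :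
    Real.exp (-β * linkOsc ν N) * sdS N ν L β G ≤
        (chiralSign (N := N) (evens ν L) * ∫ p, (plaq N ν L β (Function.update p.1 e 1) : ℂ) *
          berezin ℂ _ (G * fermiW (Function.update p.1 e p.2)) ∂((haarPi N ν L).prod (haarProbability (UN N)))).re ∧
      (chiralSign (N := N) (evens ν L) * ∫ p, (plaq N ν L β (Function.update p.1 e 1) : ℂ) *
          berezin ℂ _ (G * fermiW (Function.update p.1 e p.2)) ∂((haarPi N ν L).prod (haarProbability (UN N)))).re ≤
        Real.exp (β * linkOsc ν N) * sdS N ν L β G := by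
  rw [chiralSign_mul_mainTerm_eq hL β e hG, Complex.ofReal_re, sdS_eq_integral_prod hL β e G, ← integral_const_mul,
    ← integral_const_mul]
  have hr : ∀ p : GaugeConfig ν L (UN N) × UN N,
      0 ≤ (chiralSign (N := N) (evens ν L) * berezin ℂ _ (G * fermiW (Function.update p.1 e p.2))).re :=
    fun p => (chiralSign_mul_berezin_fermiW hL hG _).1
  have hcr : Continuous fun p : GaugeConfig ν L (UN N) × UN N =>
      (chiralSign (N := N) (evens ν L) * berezin ℂ _ (G * fermiW (Function.update p.1 e p.2))).re :=
    Complex.continuous_re.comp (continuous_const.mul (continuous_berezin_upd hL e G))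
  have hi1 := integrable_of_continuous_prod (N := N) ((continuous_plaq_upd_one β e).mul hcr)
  have hi := integrable_of_continuous_prod (N := N) ((continuous_plaq_upd (N := N) β e).mul hcr)
  constructor
  · refine integral_mono (hi.const_mul _) hi1 fun p => ?_
    dsimp only
    have h := exp_wilson_update_le (N := N) hβ p.1 e p.2 1
    have hpos : 0 < Real.exp (β * linkOsc ν N) := Real.exp_pos _
    rw [← mul_assoc]
    refine mul_le_mul_of_nonneg_right ?_ (hr p)
    rw [neg_mul, Real.exp_neg, inv_mul_le_iff₀ hpos]
    exact h
  · refine integral_mono hi1 (hi.const_mul _) fun p => ?_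
    dsimp only
    rw [← mul_assoc]
    exact mul_le_mul_of_nonneg_right (exp_wilson_update_le (N := N) hβ p.1 e 1 p.2) (hr p)

/-! ### The remainder: the oscillation of the plaquette weight against the kinetic insertion -/

/-- **Remainder bound**: `|∫∫ (e^{-βS_W(U[b←g])} - e^{-βS_W(U[b←1])}) ∫dψ̄dψ F kin_{x,b} e^{A}| ≤ κ(β) (S_β(F(σσ)_b) + S_β(F))`. [cite: SeilerLNP1982, Ch. 2] -/
theorem norm_remainder_le (hL : Even L) (hN : N ≠ 0) {β : ℝ} (hβ : 0 ≤ β) {x : TorusSite ν L} (hx : x ∈ evens ν L)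
    {e : Edge ν L} (hxe : (torusLinks ν L e).1 = x ∨ (torusLinks ν L e).2 = x) {F : FermiAlg (TorusSite ν L) N}
    (hF : IsChiralPositive (evens ν L) F) :
    ‖∫ p, ((plaq N ν L β (Function.update p.1 e p.2) : ℂ) - plaq N ν L β (Function.update p.1 e 1)) *
        berezin ℂ _ (F * kinAt x (torusLinks ν L) (stagSigns ν L) (Function.update p.1 e p.2) e * fermiW (Function.update p.1 e p.2))
        ∂((haarPi N ν L).prod (haarProbability (UN N)))‖ ≤
      kap N ν β * (sdS N ν L β (F * spinPair (torusLinks ν L e).1 (torusLinks ν L e).2) + sdS N ν L β F) := by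
  set T : FermiAlg (TorusSite ν L) N := spinPair (torusLinks ν L e).1 (torusLinks ν L e).2 with hT
  have hFT : IsChiralPositive (evens ν L) (F * T) := by
    have := hF.mul (isChiralPositive_spinPair_pow (torusLinks ν L e).1 (torusLinks ν L e).2 1); rwa [pow_one] at this
  -- the dominating function
  have hr1c : Continuous fun p : GaugeConfig ν L (UN N) × UN N =>
      (chiralSign (N := N) (evens ν L) * berezin ℂ _ (F * T * fermiW (Function.update p.1 e p.2))).re :=
    Complex.continuous_re.comp (continuous_const.mul (continuous_berezin_upd hL e _))
  have hr0c : Continuous fun p : GaugeConfig ν L (UN N) × UN N =>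
      (chiralSign (N := N) (evens ν L) * berezin ℂ _ (F * fermiW (Function.update p.1 e p.2))).re :=
    Complex.continuous_re.comp (continuous_const.mul (continuous_berezin_upd hL e _))
  have hg1 : Integrable (fun p : GaugeConfig ν L (UN N) × UN N => plaq N ν L β (Function.update p.1 e p.2) *
      (chiralSign (N := N) (evens ν L) * berezin ℂ _ (F * T * fermiW (Function.update p.1 e p.2))).re)
      ((haarPi N ν L).prod (haarProbability (UN N))) :=
    integrable_of_continuous_prod (N := N) ((continuous_plaq_upd (N := N) β e).mul hr1c)
  have hg0 : Integrable (fun p : GaugeConfig ν L (UN N) × UN N => plaq N ν L β (Function.update p.1 e p.2) *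
      (chiralSign (N := N) (evens ν L) * berezin ℂ _ (F * fermiW (Function.update p.1 e p.2))).re)
      ((haarPi N ν L).prod (haarProbability (UN N))) :=
    integrable_of_continuous_prod (N := N) ((continuous_plaq_upd (N := N) β e).mul hr0c)
  have hbound : ∀ p : GaugeConfig ν L (UN N) × UN N,
      ‖((plaq N ν L β (Function.update p.1 e p.2) : ℂ) - plaq N ν L β (Function.update p.1 e 1)) *
        berezin ℂ _ (F * kinAt x (torusLinks ν L) (stagSigns ν L) (Function.update p.1 e p.2) e * fermiW (Function.update p.1 e p.2))‖ ≤
      kap N ν β * (plaq N ν L β (Function.update p.1 e p.2) *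
          (chiralSign (N := N) (evens ν L) * berezin ℂ _ (F * T * fermiW (Function.update p.1 e p.2))).re +
        plaq N ν L β (Function.update p.1 e p.2) *
          (chiralSign (N := N) (evens ν L) * berezin ℂ _ (F * fermiW (Function.update p.1 e p.2))).re) := by
    intro p
    have hosc := abs_exp_wilson_update_sub_le (N := N) hβ p.1 e p.2 1
    have hup := exp_wilson_update_le (N := N) hβ p.1 e 1 p.2
    have hkin := norm_berezin_kinAt_le hL hN hx hxe hF (Function.update p.1 e p.2)
    have hr1 := (chiralSign_mul_berezin_fermiW hL hFT (Function.update p.1 e p.2)).1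
    have hr0 := (chiralSign_mul_berezin_fermiW hL hF (Function.update p.1 e p.2)).1
    have hδ : 0 ≤ Real.exp (β * linkOsc ν N) - 1 := by
      linarith [Real.one_le_exp (mul_nonneg hβ (linkOsc_nonneg ν N))]
    rw [norm_mul, ← Complex.ofReal_sub, Complex.norm_real, Real.norm_eq_abs]
    change |plaq N ν L β (Function.update p.1 e p.2) - plaq N ν L β (Function.update p.1 e 1)| * _ ≤ _
    calc |plaq N ν L β (Function.update p.1 e p.2) - plaq N ν L β (Function.update p.1 e 1)| *
          ‖berezin ℂ _ (F * kinAt x (torusLinks ν L) (stagSigns ν L) (Function.update p.1 e p.2) e * fermiW (Function.update p.1 e p.2))‖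
        ≤ ((Real.exp (β * linkOsc ν N) - 1) * plaq N ν L β (Function.update p.1 e 1)) *
            (((N : ℝ) * Real.sqrt N / 2) * ((chiralSign (N := N) (evens ν L) *
                berezin ℂ _ (F * T * fermiW (Function.update p.1 e p.2))).re +
              (chiralSign (N := N) (evens ν L) * berezin ℂ _ (F * fermiW (Function.update p.1 e p.2))).re)) :=
          mul_le_mul hosc hkin (norm_nonneg _) (mul_nonneg hδ (plaq_pos β _).le)
      _ ≤ ((Real.exp (β * linkOsc ν N) - 1) * (Real.exp (β * linkOsc ν N) * plaq N ν L β (Function.update p.1 e p.2))) *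
            (((N : ℝ) * Real.sqrt N / 2) * ((chiralSign (N := N) (evens ν L) *
                berezin ℂ _ (F * T * fermiW (Function.update p.1 e p.2))).re +
              (chiralSign (N := N) (evens ν L) * berezin ℂ _ (F * fermiW (Function.update p.1 e p.2))).re)) :=
          mul_le_mul_of_nonneg_right (mul_le_mul_of_nonneg_left hup hδ) (mul_nonneg (by positivity) (add_nonneg hr1 hr0))
      _ = _ := by rw [kap]; ring
  have hg : Integrable (fun p : GaugeConfig ν L (UN N) × UN N =>
      kap N ν β * (plaq N ν L β (Function.update p.1 e p.2) *
          (chiralSign (N := N) (evens ν L) * berezin ℂ _ (F * T * fermiW (Function.update p.1 e p.2))).re +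
        plaq N ν L β (Function.update p.1 e p.2) *
          (chiralSign (N := N) (evens ν L) * berezin ℂ _ (F * fermiW (Function.update p.1 e p.2))).re))
      ((haarPi N ν L).prod (haarProbability (UN N))) := (hg1.add hg0).const_mul _
  refine (norm_integral_le_of_norm_le hg (ae_of_all _ hbound)).trans (le_of_eq ?_)
  rw [integral_const_mul, integral_add hg1 hg0, ← sdS_eq_integral_prod hL β e, ← sdS_eq_integral_prod hL β e]

end SchwingerDyson

end Summit.Ventures.YMGap.Conjectures
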